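import Summits.QuantumFields.YangMills.Theorems.BalabanUVNodesN12WindowGaugeLetterUniformSocket
import Summits.QuantumFields.YangMills.Theorems.BalabanUVNodesN12WindowGaugeLetterUniformLam
import Literature.MathematicalPhysics.QuantumFieldTheory.Balaban1983to89.B15Prop1WindowDirectPackageFromLettersB
import HarnessLib

/-!
# BalabanUVNodes ∕ N12 — THE `k`-UNIFORM WINDOW GAUGE LETTER IN THE SOCKET's SHAPE AT PRINT's DATUM `Λ(Z) = lamBondsSeq (maxDomT ν.M₁ Z) k` ([Balaban1984PropagatorsII] (2.3)): dag-n12-w6's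
# `…N12WindowGaugeLetterUniformSocket` RE-KEYED — the binder `hσW` of this seat's `B15Prop1WindowDirectPackageFromLettersB.hWD_of_windowLetters_on` (✓p775205) at `bd := fun k Ω => lamBondsSeq Ω k`,
# per instance and in family form, from `…N12WindowGaugeLetterUniformLam.exists_windowGauge_uniform_le_lamBondsSeq` — O1 module (11c) of the gauge-letter chain (dag-n12-d CEDE ∕ dag-lead WORDS
# 426∕427∕430, pub-ymgap INBOX 2026-08-30)

[Balaban1984PropagatorsII] = «[II]», (2.3) p. 224; [Balaban1989LargeFieldII] CMP 122 (1989) 355–392, p. 357; [Balaban1985Variational] = «[15]», (2)–(4) p. 278, Thm 1 (8) p. 279, (16)–(18) p. 280;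
[Balaban1985RegularSpaces] (1.7) p. 77, (1.19) p. 79; [Balaban1985Averaging] Prop. 2 (52)–(53) p. 26; [Balaban1988Convergent] = «[III]», (2.2) p. 255, (2.11)–(2.13) pp. 256–257, (2.16) p. 257.

Cell `pub-ymgap` (HUMAN RULINGS D-0062 ∕ D-0149), lane `pub-ymgap-dag-n12-c` g37 (R134 seat (a), N12 = [B15], s1, lane owner); `--kind proof --supports` K1⁹ `stmt-QuantumFields-27364` `--as helper`;
count-neutral.  THEOREMS ONLY (0 `def`, 0 `instance`, 0 `sorry`); the parent's three theorems with their proof texts (tree bytes, `work/gen_socket_lam.py`) and the substitutions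
`IsMinimizer … (Bj ν.M₁ Z k) ↦ IsMinimizerB … (lamBondsSeq (maxDomT ν.M₁ Z) k)` (per instance and per family member, in the hypotheses `hmin`∕`hU` and in the conclusions) and
`bondsOf (Bj ν.M₁ Z k j) ↦ lamBondsSeq (maxDomT ν.M₁ Z) k j` in the root letter `hu`; every other binder byte-identical; one `obtain` on (11b).
DECL MAP (old → new): `N12WindowGaugeLetterUniformSocket.{hσW_uniform_of_plaqSmall, hσW_on_uniform_of_plaqSmall, hσW_on_uniform_of_class} ↦
N12WindowGaugeLetterUniformSocketLam.{hσW_uniform_of_plaqSmall_lamBondsSeq, hσW_on_uniform_of_plaqSmall_lamBondsSeq, hσW_on_uniform_of_class_lamBondsSeq}`.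
SOCKET CHECK.  The family forms are, binder for binder, the hypothesis `hσW` of `B15Prop1WindowDirectPackageFromLettersB.hWD_of_windowLetters_on` read at `bd := fun k Ω => lamBondsSeq Ω k`
(`bd (k i) (maxDomT ν.M₁ (Z i)) j = lamBondsSeq (maxDomT ν.M₁ (Z i)) (k i) j` by `rfl`).

HONEST FRAMING.  ∃∕∀ bookkeeping by name; the minimiser ([15] Thm 1 ∕ (E)), the plaquette letter ∕ class, the region datum, the window rows and the numerics stay HYPOTHESES; the constants
are `C(d, L)` — uniform in `k` and in the volume, NOT print's `O(1)` bookkeeping of [15] (16)–(18) verbatim; nothing of Bałaban's asserted or refuted beyond the cited tree theorems; count-neutral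
helper (`--supports 27364`); N12 NOT discharged; K0⁷∕K1⁹ NOT closed; counts of record unmoved (typed 28∕28 · discharged 8∕27); one finite 𝕋⁴ programme at fixed `ε = L^{-K}` — R4 closes the
conditional rung `BalabanLadder.UV` only; the Yang–Mills mass gap (Clay) is NOT proved by any of this; nothing continuum ∕ ℝ⁴ ∕ OS.
-/

noncomputable section

open scoped Matrix.Norms.L2Operator BigOperators

namespace Summit.QuantumFields.YangMills.BalabanUVNodes.N12WindowGaugeLetterUniformSocketLam

open Literature.MathematicalPhysics.QuantumFieldTheory.Balaban1983to89
open T4Continuum GaugeField B15DeterminingSets B15DeterminingSetsB BlockAveraging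
open T4CubeChartGnomonic (SU2)
open B16Sect1Backgrounds (toMS)
open T4AxialGaugeSmallField (boxBonds castSite)
open B16Eq18Proof (box)
open B14.Eq213MaximalDomains (side)
open B14.Eq213DetSet (Bj maxDomT)
open B14.Eq216Concrete (feeds)
open B14.Eq22Determines (blockIter)
open B8Eq17ClassAkV1 (plaqsOf)
open B15Prop1Carrier (plaqsInside)
open ExpMeanLog (deltaSU)
open Literature.MathematicalPhysics.QuantumFieldTheory.BalabanImbrieJaffe1984to88.BIJ85Eq453GaugeField (qsstarGIter0)
open Summit.QuantumFields.YangMills.BalabanUVNodes.N12WindowGaugeLetterUniformLam (exists_windowGauge_uniform_le_lamBondsSeq)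

/-! ## The window gauge letter (σ)_W of the direct road at print's datum: per instance, and the family form of `B15Prop1WindowDirectPackageFromLettersB.hWD_of_windowLetters_on`'s binder `hσW` -/

/-- ★★★ **[PRINT's DATUM `Λ(Z)` ([Balaban1984PropagatorsII] (2.3) p.224): `hmin ↦ IsMinimizerB … (lamBondsSeq (maxDomT ν.M₁ Z) k) …`, `hu` on print members; one `obtain` on `…N12WindowGaugeLetterUniformLam.exists_windowGauge_uniform_le_lamBondsSeq`.]** **THE WINDOW GAUGE LETTER (σ)_W OF THE DIRECT ROAD, PER INSTANCE, `k`-UNIFORM.**  `exists_windowGauge_uniform_le_lamBondsSeq` read in the shape of the (WD) package's letter (dag-n12-c's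
`B15Prop1WindowDirectPackageFromLetters.hWD_of_windowLetters_on`, binder `hσW`): a residual gauge `σ` of the minimiser with the ROOT LETTER `hu`, `σ • U₀` bond-wise `δc`-near `1` on the four bonds of
every plaquette of the window `Wp`, and `δW`-near `1` on the feeds of the four bonds of every `(e₀, e_ν′)`-plaquette of the window box `box (n+3) (lo−2)` (level `k`) — for ANY `δc, δW` dominating the
`k`-FREE tolerance `((4d+m′+3)²·L²∕4 + 24·m′·((d+2)L)²∕4)·ε + m′·ρn`, from ONE plaquette letter at level `k − 1`, the window's nearness to `Ω_k` (`hXΩ`, `hfit`), the region-box row `hBox` and the two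
window rows `hWX`, `hfeedsX`.  No letter off the window; no condition on the shape of `Ω₁(Z)`.
[cite: Balaban1989LargeFieldII, p.357; Balaban1985Variational, (4) p.278, (16)–(18) p.280; Balaban1988Convergent, (2.2) p.255, (2.11)–(2.12) p.256, (2.16) p.257] -/
theorem hσW_uniform_of_plaqSmall_lamBondsSeq {F : T4Family} (ν : Node00.Stage7Numerics) (Kt : ℕ) (h0 : 0 < (F.P Kt).d) {k : ℕ} (hk0 : 0 < k) (hk : k ≤ (F.P Kt).m + (F.P Kt).K)
    (hdiv : side (F.P Kt).L ν.M₁ k ∣ (F.P Kt).sitesPerDir 0) (Z : Set (Site (F.P Kt) 0))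
    {c : ℕ} (hkc : k + c ≤ (F.P Kt).m + (F.P Kt).K) (hc : 4 * (F.P Kt).d + (3 * ((F.P Kt).d * (((F.P Kt).L - 1) / 2)) + 5) + 3 < 2 * (F.P Kt).L ^ c)
    {ρn : ℝ} (hρn : 0 ≤ ρn)
    (W : GaugeField (F.P Kt) k SU2) (𝒞 : Set (PBond (F.P Kt) k)) (hD : ∀ c ∈ 𝒞, dist1 (W c) ≤ ρn)
    {U₀ : GaugeField (F.P Kt) 0 SU2}
    (hmin : IsMinimizerB (Node00.avOfRecord F 2 Kt) (Node00.regMSCoPOfRecord F 2 ν Kt k (maxDomT ν.M₁ Z)) (lamBondsSeq (maxDomT ν.M₁ Z) k)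
      (avgFamily (Node00.avOfRecord F 2 Kt) (qsstarGIter0 k W)) U₀)
    {ε : ℝ} (hεpos : 0 < ε)
    -- ONE graded plaquette letter at level `k − 1` ([15] Thm 1 (8) ∕ the class), FREE `ε`, Prop. 2-small
    (hUk : PlaqSmallOn (plaqsOf (Node00.topSeq (Node00.suppDomOfRecord F ν Kt (maxDomT ν.M₁ Z)) (maxDomT ν.M₁ Z) (k - 1))) (ε * (F.P Kt).eta (k - 1) ^ 2) U₀)
    (hα3 : (143 * (((((F.P Kt).d + 4 : ℕ) : ℝ)) ^ 2 / 4) ^ 2) * (ε * (F.P Kt).L ^ 2) ≤ 1 / 3)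
    (hα2 : 2 * (ε * (F.P Kt).L ^ 2) ≤ 2 * deltaSU (Fin 2) / ((((F.P Kt).d + 4) * (F.P Kt).L : ℕ) : ℝ) ^ 2)
    (haN : (((((F.P Kt).d + 2) * (F.P Kt).L : ℕ) : ℝ) ^ 2 / 4) * (2 * (ε * (F.P Kt).L ^ 2)) < deltaSU (Fin 2))
    -- THE WINDOW: within `D₀` fine steps of `Ω_k`, the collar numerics, and the region-box letter AT the window
    (X : Set (Site (F.P Kt) 0)) {D₀ : ℕ} (hXΩ : ∀ x ∈ X, ∃ x₀ ∈ maxDomT ν.M₁ Z k, ∃ w₀ : List (Letter (F.P Kt).d), w₀.length ≤ D₀ ∧ walkEnd x₀ w₀ = x)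
    (hfit : D₀ + 3 * (∑ i ∈ Finset.range (k + 1), ((F.P Kt).d * (((F.P Kt).L ^ i - 1) / 2) + 1)) + ((3 * ((F.P Kt).d * (((F.P Kt).L - 1) / 2)) + 5) + 5) * (F.P Kt).L ^ k +
      (((F.P Kt).d + 4) * (F.P Kt).L + 2) * (∑ l ∈ Finset.Ico 0 k, (F.P Kt).L ^ l) + 4 ≤ (F.P Kt).L ^ (k - 1) * ν.M₁)
    (hBox : ∀ x ∈ X, ∀ w : List (Letter (F.P Kt).d), w.length ≤ (∑ i ∈ Finset.range (k + 1), ((F.P Kt).d * (((F.P Kt).L ^ i - 1) / 2) + 1)) + (3 * ((F.P Kt).d * (((F.P Kt).L - 1) / 2)) + 5) * (F.P Kt).L ^ k + (F.P Kt).L ^ k →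
      ∀ μ : Fin (F.P Kt).d, (⟨blockIter k (walkEnd x w), μ⟩ : PBond (F.P Kt) k) ∈ 𝒞)
    -- the WINDOW of the direct road: its level-`k` box `box (n+3) (lo−2)` and the plaquette window `Wp`, with the two window rows
    (lo hi : Fin (F.P Kt).d → ℤ) (Wp : Finset (Plaq (F.P Kt) 0))
    (hWX : ∀ p ∈ Wp, p.src ∈ X ∧ p.src.shift p.μ ∈ X ∧ p.src.shift p.ν ∈ X ∧ (p.src.shift p.μ).shift p.ν ∈ X ∧ (p.src.shift p.ν).shift p.μ ∈ X)
    (hfeedsX : ∀ (ν' : Fin (F.P Kt).d), ∀ z ∈ box (fun κ => (hi κ - lo κ + 1).toNat + 3) (fun κ => lo κ - 2), ∀ b₀ : PBond (F.P Kt) 0,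
      (b₀ ∈ feeds k (⟨(castSite z : Site (F.P Kt) k), ⟨0, h0⟩⟩ : PBond (F.P Kt) k) ∨
        b₀ ∈ feeds k (⟨((castSite z : Site (F.P Kt) k)).shift ⟨0, h0⟩, ν'⟩ : PBond (F.P Kt) k) ∨
        b₀ ∈ feeds k (⟨((castSite z : Site (F.P Kt) k)).shift ν', ⟨0, h0⟩⟩ : PBond (F.P Kt) k) ∨
        b₀ ∈ feeds k (⟨(castSite z : Site (F.P Kt) k), ν'⟩ : PBond (F.P Kt) k)) → b₀.src ∈ X ∧ b₀.tgt ∈ X)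
    -- any tolerances dominating the `k`-free window tolerance of `exists_windowGauge_uniform_le_lamBondsSeq`
    {δc δW : ℝ}
    (hδc : ((((4 * (F.P Kt).d + (3 * ((F.P Kt).d * (((F.P Kt).L - 1) / 2)) + 5) + 3 : ℕ) : ℝ)) ^ 2 * ((F.P Kt).L : ℝ) ^ 2 / 4 + ((3 * ((F.P Kt).d * (((F.P Kt).L - 1) / 2)) + 5 : ℕ) : ℝ) * (24 * (((((F.P Kt).d + 2) * (F.P Kt).L : ℕ) : ℝ) ^ 2 / 4))) * ε + ((3 * ((F.P Kt).d * (((F.P Kt).L - 1) / 2)) + 5 : ℕ) : ℝ) * ρn ≤ δc)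
    (hδW : ((((4 * (F.P Kt).d + (3 * ((F.P Kt).d * (((F.P Kt).L - 1) / 2)) + 5) + 3 : ℕ) : ℝ)) ^ 2 * ((F.P Kt).L : ℝ) ^ 2 / 4 + ((3 * ((F.P Kt).d * (((F.P Kt).L - 1) / 2)) + 5 : ℕ) : ℝ) * (24 * (((((F.P Kt).d + 2) * (F.P Kt).L : ℕ) : ℝ) ^ 2 / 4))) * ε + ((3 * ((F.P Kt).d * (((F.P Kt).L - 1) / 2)) + 5 : ℕ) : ℝ) * ρn ≤ δW) :
    ∃ σ : GaugeTransf (F.P Kt) 0 SU2,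
      (∀ j, j ≤ k → ∀ b ∈ lamBondsSeq (maxDomT ν.M₁ Z) k j, toMS σ j b.src = 1 ∧ toMS σ j b.tgt = 1) ∧
      (∀ p ∈ Wp, ‖((gaugeAct σ U₀ ⟨p.src, p.μ⟩ : SU2) : Matrix (Fin 2) (Fin 2) ℂ) - 1‖ ≤ δc ∧ ‖((gaugeAct σ U₀ ⟨p.src.shift p.μ, p.ν⟩ : SU2) : Matrix (Fin 2) (Fin 2) ℂ) - 1‖ ≤ δc ∧
        ‖((gaugeAct σ U₀ ⟨p.src.shift p.ν, p.μ⟩ : SU2) : Matrix (Fin 2) (Fin 2) ℂ) - 1‖ ≤ δc ∧ ‖((gaugeAct σ U₀ ⟨p.src, p.ν⟩ : SU2) : Matrix (Fin 2) (Fin 2) ℂ) - 1‖ ≤ δc) ∧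
      (∀ (ν' : Fin (F.P Kt).d), ∀ z ∈ box (fun κ => (hi κ - lo κ + 1).toNat + 3) (fun κ => lo κ - 2), ∀ b₀ : PBond (F.P Kt) 0,
        (b₀ ∈ feeds k (⟨(castSite z : Site (F.P Kt) k), ⟨0, h0⟩⟩ : PBond (F.P Kt) k) ∨
          b₀ ∈ feeds k (⟨((castSite z : Site (F.P Kt) k)).shift ⟨0, h0⟩, ν'⟩ : PBond (F.P Kt) k) ∨
          b₀ ∈ feeds k (⟨((castSite z : Site (F.P Kt) k)).shift ν', ⟨0, h0⟩⟩ : PBond (F.P Kt) k) ∨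
          b₀ ∈ feeds k (⟨(castSite z : Site (F.P Kt) k), ν'⟩ : PBond (F.P Kt) k)) →
        ‖((gaugeAct σ U₀ b₀ : SU2) : Matrix (Fin 2) (Fin 2) ℂ) - 1‖ ≤ δW) := by
  obtain ⟨σ, hu, -, hb⟩ := exists_windowGauge_uniform_le_lamBondsSeq ν Kt hk0 hk hdiv Z hkc hc hρn W 𝒞 hD hmin hεpos hUk hα3 hα2 haN X hXΩ hfit hBox
  refine ⟨σ, hu, fun p hp => ?_, fun ν' z hz b₀ hb₀ => ?_⟩
  · obtain ⟨h1, h2, h3, h4, h5⟩ := hWX p hp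
    exact ⟨(hb ⟨p.src, p.μ⟩ h1 h2).trans hδc, (hb ⟨p.src.shift p.μ, p.ν⟩ h2 h4).trans hδc, (hb ⟨p.src.shift p.ν, p.μ⟩ h3 h5).trans hδc,
      (hb ⟨p.src, p.ν⟩ h1 h3).trans hδc⟩
  · obtain ⟨hs, ht⟩ := hfeedsX ν' z hz b₀ hb₀
    exact (hb b₀ hs ht).trans hδW

/-- ★★★ **[PRINT's DATUM: the minimiser binders of `hU` and of the conclusion are `IsMinimizerB … (lamBondsSeq (maxDomT ν.M₁ (Z i)) (k i)) …`, `hu` on print members — literally the binder `hσW` of `B15Prop1WindowDirectPackageFromLettersB.hWD_of_windowLetters_on` at `bd := fun k Ω => lamBondsSeq Ω k`.]** **THE FAMILY FORM, FREE SCALE — LITERALLY THE BINDER `hσW` OF `hWD_of_windowLetters_on` (p658881 :108–122), `k`-UNIFORM FLOORS**, datum `W := ext i V_k`, region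
`𝒞 := boxBonds (LO i) (HI i)`, `hD := hnV`: per instance `i`, from the numerics, ONE graded plaquette letter at level `k_i − 1` at every (2.12) minimiser of every guarded normalised datum ([15] Thm 1 (8)
at a free scale `ε i` — the frame print's graded bookkeeping feeds), the window `X i` within `D₀ i` of `Ω_{k_i}(Z_i)` with the collar row `hfit`, the region-box row and the two window rows, and
tolerances `δc i, δW i ≥ ((4d+m′+3)²·L²∕4 + 24·m′·((d+2)L)²∕4)·ε i + m′·ρn i` (no `k_i`!) — the window gauge letter (σ)_W.
[cite: Balaban1989LargeFieldII, p.357; Balaban1985Variational, (4) p.278, Thm 1 (8) p.279, (16)–(18) p.280; Balaban1988Convergent, (2.2) p.255, (2.11)–(2.13) pp.256–257, (2.16) p.257] -/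
theorem hσW_on_uniform_of_plaqSmall_lamBondsSeq {F : T4Family} (ν : Node00.Stage7Numerics) (Kt : ℕ) (h0 : 0 < (F.P Kt).d) {ι : Type}
    (Z Λ : ι → Set (Site (F.P Kt) 0)) (k : ι → ℕ) (hk0 : ∀ i, 0 < k i) (hk : ∀ i, k i ≤ (F.P Kt).m + (F.P Kt).K)
    (eR : ι → ℝ) (lo hi : ι → Fin (F.P Kt).d → ℤ)
    (ext : ∀ i, GaugeField (F.P Kt) (k i) SU2 → GaugeField (F.P Kt) (k i) SU2)
    (LO HI : ι → Fin (F.P Kt).d → ℤ) (ρn : ι → ℝ) (hρn : ∀ i, 0 ≤ ρn i)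
    (hdiv : ∀ i, side (F.P Kt).L ν.M₁ (k i) ∣ (F.P Kt).sitesPerDir 0)
    -- NUMERICS per instance: level guard (no wrapping); radii
    (c : ι → ℕ) (hkc : ∀ i, k i + c i ≤ (F.P Kt).m + (F.P Kt).K) (hc : ∀ i, 4 * (F.P Kt).d + (3 * ((F.P Kt).d * (((F.P Kt).L - 1) / 2)) + 5) + 3 < 2 * (F.P Kt).L ^ c i)
    (W : ι → Finset (Plaq (F.P Kt) 0))
    -- ONE graded plaquette letter at level `k i − 1`, FREE scale `ε i`, at every minimiser of every guarded normalised datum ([15] Thm 1 (8) ∕ the class), Prop. 2-small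
    {ε : ι → ℝ} (hεpos : ∀ i, 0 < ε i)
    (hα3 : ∀ i, (143 * (((((F.P Kt).d + 4 : ℕ) : ℝ)) ^ 2 / 4) ^ 2) * (ε i * (F.P Kt).L ^ 2) ≤ 1 / 3)
    (hα2 : ∀ i, 2 * (ε i * (F.P Kt).L ^ 2) ≤ 2 * deltaSU (Fin 2) / ((((F.P Kt).d + 4) * (F.P Kt).L : ℕ) : ℝ) ^ 2)
    (haN : ∀ i, (((((F.P Kt).d + 2) * (F.P Kt).L : ℕ) : ℝ) ^ 2 / 4) * (2 * (ε i * (F.P Kt).L ^ 2)) < deltaSU (Fin 2))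
    (hU : ∀ i (Vk : GaugeField (F.P Kt) (k i) SU2), PlaqSmallOn (plaqsInside (pts (k i) (Z i ∩ (Λ i)ᶜ))) (eR i) Vk →
      (∀ b ∈ (boxBonds (LO i) (HI i) : Set (PBond (F.P Kt) (k i))), dist1 (ext i Vk b) ≤ ρn i) →
      ∀ U₀ : GaugeField (F.P Kt) 0 SU2,
        IsMinimizerB (Node00.avOfRecord F 2 Kt) (Node00.regMSCoPOfRecord F 2 ν Kt (k i) (maxDomT ν.M₁ (Z i))) (lamBondsSeq (maxDomT ν.M₁ (Z i)) (k i))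
          (avgFamily (Node00.avOfRecord F 2 Kt) (qsstarGIter0 (k i) (ext i Vk))) U₀ →
        PlaqSmallOn (plaqsOf (Node00.topSeq (Node00.suppDomOfRecord F ν Kt (maxDomT ν.M₁ (Z i))) (maxDomT ν.M₁ (Z i)) (k i - 1))) (ε i * (F.P Kt).eta (k i - 1) ^ 2) U₀)
    -- the WINDOW per instance: within `D₀ i` of `Ω_{k_i}(Z_i)`, the collar numerics, the REGION-BOX ROW and the two window rows
    (X : ι → Set (Site (F.P Kt) 0)) (D₀ : ι → ℕ)
    (hXΩ : ∀ i, ∀ x ∈ X i, ∃ x₀ ∈ maxDomT ν.M₁ (Z i) (k i), ∃ w₀ : List (Letter (F.P Kt).d), w₀.length ≤ D₀ i ∧ walkEnd x₀ w₀ = x)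
    (hfit : ∀ i, D₀ i + 3 * (∑ i' ∈ Finset.range (k i + 1), ((F.P Kt).d * (((F.P Kt).L ^ i' - 1) / 2) + 1)) + ((3 * ((F.P Kt).d * (((F.P Kt).L - 1) / 2)) + 5) + 5) * (F.P Kt).L ^ k i +
      (((F.P Kt).d + 4) * (F.P Kt).L + 2) * (∑ l ∈ Finset.Ico 0 (k i), (F.P Kt).L ^ l) + 4 ≤ (F.P Kt).L ^ (k i - 1) * ν.M₁)
    (hBox : ∀ i, ∀ x ∈ X i, ∀ w : List (Letter (F.P Kt).d),
      w.length ≤ (∑ i' ∈ Finset.range (k i + 1), ((F.P Kt).d * (((F.P Kt).L ^ i' - 1) / 2) + 1)) + (3 * ((F.P Kt).d * (((F.P Kt).L - 1) / 2)) + 5) * (F.P Kt).L ^ k i + (F.P Kt).L ^ k i →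
      ∀ μ : Fin (F.P Kt).d, (⟨blockIter (k i) (walkEnd x w), μ⟩ : PBond (F.P Kt) (k i)) ∈ (boxBonds (LO i) (HI i) : Set (PBond (F.P Kt) (k i))))
    (hWX : ∀ i, ∀ p ∈ W i, p.src ∈ X i ∧ p.src.shift p.μ ∈ X i ∧ p.src.shift p.ν ∈ X i ∧ (p.src.shift p.μ).shift p.ν ∈ X i ∧ (p.src.shift p.ν).shift p.μ ∈ X i)
    (hfeedsX : ∀ i (ν' : Fin (F.P Kt).d), ∀ z ∈ box (fun κ => (hi i κ - lo i κ + 1).toNat + 3) (fun κ => lo i κ - 2), ∀ b₀ : PBond (F.P Kt) 0,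
      (b₀ ∈ feeds (k i) (⟨(castSite z : Site (F.P Kt) (k i)), ⟨0, h0⟩⟩ : PBond (F.P Kt) (k i)) ∨
        b₀ ∈ feeds (k i) (⟨((castSite z : Site (F.P Kt) (k i))).shift ⟨0, h0⟩, ν'⟩ : PBond (F.P Kt) (k i)) ∨
        b₀ ∈ feeds (k i) (⟨((castSite z : Site (F.P Kt) (k i))).shift ν', ⟨0, h0⟩⟩ : PBond (F.P Kt) (k i)) ∨
        b₀ ∈ feeds (k i) (⟨(castSite z : Site (F.P Kt) (k i)), ν'⟩ : PBond (F.P Kt) (k i))) → b₀.src ∈ X i ∧ b₀.tgt ∈ X i)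
    -- the instance's tolerances dominate the `k`-FREE window tolerance of `exists_windowGauge_uniform_le_lamBondsSeq`
    {δc δW : ι → ℝ}
    (hδc : ∀ i, ((((4 * (F.P Kt).d + (3 * ((F.P Kt).d * (((F.P Kt).L - 1) / 2)) + 5) + 3 : ℕ) : ℝ)) ^ 2 * ((F.P Kt).L : ℝ) ^ 2 / 4 + ((3 * ((F.P Kt).d * (((F.P Kt).L - 1) / 2)) + 5 : ℕ) : ℝ) * (24 * (((((F.P Kt).d + 2) * (F.P Kt).L : ℕ) : ℝ) ^ 2 / 4))) * ε i + ((3 * ((F.P Kt).d * (((F.P Kt).L - 1) / 2)) + 5 : ℕ) : ℝ) * ρn i ≤ δc i)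
    (hδW : ∀ i, ((((4 * (F.P Kt).d + (3 * ((F.P Kt).d * (((F.P Kt).L - 1) / 2)) + 5) + 3 : ℕ) : ℝ)) ^ 2 * ((F.P Kt).L : ℝ) ^ 2 / 4 + ((3 * ((F.P Kt).d * (((F.P Kt).L - 1) / 2)) + 5 : ℕ) : ℝ) * (24 * (((((F.P Kt).d + 2) * (F.P Kt).L : ℕ) : ℝ) ^ 2 / 4))) * ε i + ((3 * ((F.P Kt).d * (((F.P Kt).L - 1) / 2)) + 5 : ℕ) : ℝ) * ρn i ≤ δW i) :
    ∀ i (Vk : GaugeField (F.P Kt) (k i) SU2), PlaqSmallOn (plaqsInside (pts (k i) (Z i ∩ (Λ i)ᶜ))) (eR i) Vk →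
      (∀ b ∈ (boxBonds (LO i) (HI i) : Set (PBond (F.P Kt) (k i))), dist1 (ext i Vk b) ≤ ρn i) →
      ∀ U₀ : GaugeField (F.P Kt) 0 SU2,
        IsMinimizerB (Node00.avOfRecord F 2 Kt) (Node00.regMSCoPOfRecord F 2 ν Kt (k i) (maxDomT ν.M₁ (Z i))) (lamBondsSeq (maxDomT ν.M₁ (Z i)) (k i))
          (avgFamily (Node00.avOfRecord F 2 Kt) (qsstarGIter0 (k i) (ext i Vk))) U₀ →
        ∃ σ : GaugeTransf (F.P Kt) 0 SU2,
          (∀ j, j ≤ k i → ∀ b ∈ lamBondsSeq (maxDomT ν.M₁ (Z i)) (k i) j, toMS σ j b.src = 1 ∧ toMS σ j b.tgt = 1) ∧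
          (∀ p ∈ W i, ‖((gaugeAct σ U₀ ⟨p.src, p.μ⟩ : SU2) : Matrix (Fin 2) (Fin 2) ℂ) - 1‖ ≤ δc i ∧ ‖((gaugeAct σ U₀ ⟨p.src.shift p.μ, p.ν⟩ : SU2) : Matrix (Fin 2) (Fin 2) ℂ) - 1‖ ≤ δc i ∧
            ‖((gaugeAct σ U₀ ⟨p.src.shift p.ν, p.μ⟩ : SU2) : Matrix (Fin 2) (Fin 2) ℂ) - 1‖ ≤ δc i ∧ ‖((gaugeAct σ U₀ ⟨p.src, p.ν⟩ : SU2) : Matrix (Fin 2) (Fin 2) ℂ) - 1‖ ≤ δc i) ∧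
          (∀ (ν' : Fin (F.P Kt).d), ∀ z ∈ box (fun κ => (hi i κ - lo i κ + 1).toNat + 3) (fun κ => lo i κ - 2), ∀ b₀ : PBond (F.P Kt) 0,
            (b₀ ∈ feeds (k i) (⟨(castSite z : Site (F.P Kt) (k i)), ⟨0, h0⟩⟩ : PBond (F.P Kt) (k i)) ∨
              b₀ ∈ feeds (k i) (⟨((castSite z : Site (F.P Kt) (k i))).shift ⟨0, h0⟩, ν'⟩ : PBond (F.P Kt) (k i)) ∨
              b₀ ∈ feeds (k i) (⟨((castSite z : Site (F.P Kt) (k i))).shift ν', ⟨0, h0⟩⟩ : PBond (F.P Kt) (k i)) ∨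
              b₀ ∈ feeds (k i) (⟨(castSite z : Site (F.P Kt) (k i)), ν'⟩ : PBond (F.P Kt) (k i))) →
            ‖((gaugeAct σ U₀ b₀ : SU2) : Matrix (Fin 2) (Fin 2) ℂ) - 1‖ ≤ δW i) := by
  intro i Vk hV hnV U₀ hmin0
  exact hσW_uniform_of_plaqSmall_lamBondsSeq ν Kt h0 (hk0 i) (hk i) (hdiv i) (Z i) (hkc i) (hc i) (hρn i) (ext i Vk) (boxBonds (LO i) (HI i)) hnV hmin0 (hεpos i)
    (hU i Vk hV hnV U₀ hmin0) (hα3 i) (hα2 i) (haN i) (X i) (hXΩ i) (hfit i) (hBox i) (lo i) (hi i) (W i) (hWX i) (hfeedsX i) (hδc i) (hδW i)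

/-- ★★★ **[PRINT's DATUM: as above, `ε i := εreg`.]** **THE FAMILY FORM, CLASS CORNER, `k`-UNIFORM FLOORS** — `hσW_on_uniform_of_plaqSmall_lamBondsSeq` with the ONE level-`(k_i−1)` plaquette letter read off the minimiser's OWN CLASS OF RECORD
(`hmin.1`, [15] (2) ∕ [6] (1.7) on `Ω_{k_i−1}`) at `ε i := εreg`: the binder `hσW` of `hWD_of_windowLetters_on` from NUMERICS (`εreg` ×4, level guard, `hdiv`), the window rows (`hXΩ`, `hfit`, `hBox`,
`hWX`, `hfeedsX` — lattice geometry of the instance) and the `k`-FREE tolerance floors `δc i, δW i ≥ ((4d+m′+3)²·L²∕4 + 24·m′·((d+2)L)²∕4)·εreg + m′·ρn i` ONLY.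
[cite: Balaban1985Variational, (2)–(4) p.278, (16)–(18) p.280; Balaban1985RegularSpaces, (1.7) p.77, (1.19) p.79; Balaban1985Averaging, Prop. 2 (52)–(53) p.26; Balaban1988Convergent, (2.12)–(2.13) pp.256–257, (2.16) p.257] -/
theorem hσW_on_uniform_of_class_lamBondsSeq {F : T4Family} (ν : Node00.Stage7Numerics) (Kt : ℕ) (h0 : 0 < (F.P Kt).d) {ι : Type}
    (Z Λ : ι → Set (Site (F.P Kt) 0)) (k : ι → ℕ) (hk0 : ∀ i, 0 < k i) (hk : ∀ i, k i ≤ (F.P Kt).m + (F.P Kt).K)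
    (eR : ι → ℝ) (lo hi : ι → Fin (F.P Kt).d → ℤ)
    (ext : ∀ i, GaugeField (F.P Kt) (k i) SU2 → GaugeField (F.P Kt) (k i) SU2)
    (LO HI : ι → Fin (F.P Kt).d → ℤ) (ρn : ι → ℝ) (hρn : ∀ i, 0 ≤ ρn i)
    (hdiv : ∀ i, side (F.P Kt).L ν.M₁ (k i) ∣ (F.P Kt).sitesPerDir 0)
    -- NUMERICS per instance: level guard (no wrapping); radii
    (c : ι → ℕ) (hkc : ∀ i, k i + c i ≤ (F.P Kt).m + (F.P Kt).K) (hc : ∀ i, 4 * (F.P Kt).d + (3 * ((F.P Kt).d * (((F.P Kt).L - 1) / 2)) + 5) + 3 < 2 * (F.P Kt).L ^ c i)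
    (W : ι → Finset (Plaq (F.P Kt) 0))
    -- the class threshold `εreg`: positive and small
    (hεpos : 0 < ν.εreg)
    (hα3 : (143 * (((((F.P Kt).d + 4 : ℕ) : ℝ)) ^ 2 / 4) ^ 2) * (ν.εreg * (F.P Kt).L ^ 2) ≤ 1 / 3)
    (hα2 : 2 * (ν.εreg * (F.P Kt).L ^ 2) ≤ 2 * deltaSU (Fin 2) / ((((F.P Kt).d + 4) * (F.P Kt).L : ℕ) : ℝ) ^ 2)
    (haN : (((((F.P Kt).d + 2) * (F.P Kt).L : ℕ) : ℝ) ^ 2 / 4) * (2 * (ν.εreg * (F.P Kt).L ^ 2)) < deltaSU (Fin 2))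
    -- the WINDOW per instance: within `D₀ i` of `Ω_{k_i}(Z_i)`, the collar numerics, the REGION-BOX ROW and the two window rows
    (X : ι → Set (Site (F.P Kt) 0)) (D₀ : ι → ℕ)
    (hXΩ : ∀ i, ∀ x ∈ X i, ∃ x₀ ∈ maxDomT ν.M₁ (Z i) (k i), ∃ w₀ : List (Letter (F.P Kt).d), w₀.length ≤ D₀ i ∧ walkEnd x₀ w₀ = x)
    (hfit : ∀ i, D₀ i + 3 * (∑ i' ∈ Finset.range (k i + 1), ((F.P Kt).d * (((F.P Kt).L ^ i' - 1) / 2) + 1)) + ((3 * ((F.P Kt).d * (((F.P Kt).L - 1) / 2)) + 5) + 5) * (F.P Kt).L ^ k i +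
      (((F.P Kt).d + 4) * (F.P Kt).L + 2) * (∑ l ∈ Finset.Ico 0 (k i), (F.P Kt).L ^ l) + 4 ≤ (F.P Kt).L ^ (k i - 1) * ν.M₁)
    (hBox : ∀ i, ∀ x ∈ X i, ∀ w : List (Letter (F.P Kt).d),
      w.length ≤ (∑ i' ∈ Finset.range (k i + 1), ((F.P Kt).d * (((F.P Kt).L ^ i' - 1) / 2) + 1)) + (3 * ((F.P Kt).d * (((F.P Kt).L - 1) / 2)) + 5) * (F.P Kt).L ^ k i + (F.P Kt).L ^ k i →
      ∀ μ : Fin (F.P Kt).d, (⟨blockIter (k i) (walkEnd x w), μ⟩ : PBond (F.P Kt) (k i)) ∈ (boxBonds (LO i) (HI i) : Set (PBond (F.P Kt) (k i))))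
    (hWX : ∀ i, ∀ p ∈ W i, p.src ∈ X i ∧ p.src.shift p.μ ∈ X i ∧ p.src.shift p.ν ∈ X i ∧ (p.src.shift p.μ).shift p.ν ∈ X i ∧ (p.src.shift p.ν).shift p.μ ∈ X i)
    (hfeedsX : ∀ i (ν' : Fin (F.P Kt).d), ∀ z ∈ box (fun κ => (hi i κ - lo i κ + 1).toNat + 3) (fun κ => lo i κ - 2), ∀ b₀ : PBond (F.P Kt) 0,
      (b₀ ∈ feeds (k i) (⟨(castSite z : Site (F.P Kt) (k i)), ⟨0, h0⟩⟩ : PBond (F.P Kt) (k i)) ∨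
        b₀ ∈ feeds (k i) (⟨((castSite z : Site (F.P Kt) (k i))).shift ⟨0, h0⟩, ν'⟩ : PBond (F.P Kt) (k i)) ∨
        b₀ ∈ feeds (k i) (⟨((castSite z : Site (F.P Kt) (k i))).shift ν', ⟨0, h0⟩⟩ : PBond (F.P Kt) (k i)) ∨
        b₀ ∈ feeds (k i) (⟨(castSite z : Site (F.P Kt) (k i)), ν'⟩ : PBond (F.P Kt) (k i))) → b₀.src ∈ X i ∧ b₀.tgt ∈ X i)
    -- the instance's tolerances dominate the `k`-free window tolerance at `ε := εreg`
    {δc δW : ι → ℝ}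
    (hδc : ∀ i, ((((4 * (F.P Kt).d + (3 * ((F.P Kt).d * (((F.P Kt).L - 1) / 2)) + 5) + 3 : ℕ) : ℝ)) ^ 2 * ((F.P Kt).L : ℝ) ^ 2 / 4 + ((3 * ((F.P Kt).d * (((F.P Kt).L - 1) / 2)) + 5 : ℕ) : ℝ) * (24 * (((((F.P Kt).d + 2) * (F.P Kt).L : ℕ) : ℝ) ^ 2 / 4))) * ν.εreg + ((3 * ((F.P Kt).d * (((F.P Kt).L - 1) / 2)) + 5 : ℕ) : ℝ) * ρn i ≤ δc i)
    (hδW : ∀ i, ((((4 * (F.P Kt).d + (3 * ((F.P Kt).d * (((F.P Kt).L - 1) / 2)) + 5) + 3 : ℕ) : ℝ)) ^ 2 * ((F.P Kt).L : ℝ) ^ 2 / 4 + ((3 * ((F.P Kt).d * (((F.P Kt).L - 1) / 2)) + 5 : ℕ) : ℝ) * (24 * (((((F.P Kt).d + 2) * (F.P Kt).L : ℕ) : ℝ) ^ 2 / 4))) * ν.εreg + ((3 * ((F.P Kt).d * (((F.P Kt).L - 1) / 2)) + 5 : ℕ) : ℝ) * ρn i ≤ δW i) :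
    ∀ i (Vk : GaugeField (F.P Kt) (k i) SU2), PlaqSmallOn (plaqsInside (pts (k i) (Z i ∩ (Λ i)ᶜ))) (eR i) Vk →
      (∀ b ∈ (boxBonds (LO i) (HI i) : Set (PBond (F.P Kt) (k i))), dist1 (ext i Vk b) ≤ ρn i) →
      ∀ U₀ : GaugeField (F.P Kt) 0 SU2,
        IsMinimizerB (Node00.avOfRecord F 2 Kt) (Node00.regMSCoPOfRecord F 2 ν Kt (k i) (maxDomT ν.M₁ (Z i))) (lamBondsSeq (maxDomT ν.M₁ (Z i)) (k i))
          (avgFamily (Node00.avOfRecord F 2 Kt) (qsstarGIter0 (k i) (ext i Vk))) U₀ →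
        ∃ σ : GaugeTransf (F.P Kt) 0 SU2,
          (∀ j, j ≤ k i → ∀ b ∈ lamBondsSeq (maxDomT ν.M₁ (Z i)) (k i) j, toMS σ j b.src = 1 ∧ toMS σ j b.tgt = 1) ∧
          (∀ p ∈ W i, ‖((gaugeAct σ U₀ ⟨p.src, p.μ⟩ : SU2) : Matrix (Fin 2) (Fin 2) ℂ) - 1‖ ≤ δc i ∧ ‖((gaugeAct σ U₀ ⟨p.src.shift p.μ, p.ν⟩ : SU2) : Matrix (Fin 2) (Fin 2) ℂ) - 1‖ ≤ δc i ∧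
            ‖((gaugeAct σ U₀ ⟨p.src.shift p.ν, p.μ⟩ : SU2) : Matrix (Fin 2) (Fin 2) ℂ) - 1‖ ≤ δc i ∧ ‖((gaugeAct σ U₀ ⟨p.src, p.ν⟩ : SU2) : Matrix (Fin 2) (Fin 2) ℂ) - 1‖ ≤ δc i) ∧
          (∀ (ν' : Fin (F.P Kt).d), ∀ z ∈ box (fun κ => (hi i κ - lo i κ + 1).toNat + 3) (fun κ => lo i κ - 2), ∀ b₀ : PBond (F.P Kt) 0,
            (b₀ ∈ feeds (k i) (⟨(castSite z : Site (F.P Kt) (k i)), ⟨0, h0⟩⟩ : PBond (F.P Kt) (k i)) ∨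
              b₀ ∈ feeds (k i) (⟨((castSite z : Site (F.P Kt) (k i))).shift ⟨0, h0⟩, ν'⟩ : PBond (F.P Kt) (k i)) ∨
              b₀ ∈ feeds (k i) (⟨((castSite z : Site (F.P Kt) (k i))).shift ν', ⟨0, h0⟩⟩ : PBond (F.P Kt) (k i)) ∨
              b₀ ∈ feeds (k i) (⟨(castSite z : Site (F.P Kt) (k i)), ν'⟩ : PBond (F.P Kt) (k i))) →
            ‖((gaugeAct σ U₀ b₀ : SU2) : Matrix (Fin 2) (Fin 2) ℂ) - 1‖ ≤ δW i) := by
  intro i Vk _ hnV U₀ hmin0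
  exact hσW_uniform_of_plaqSmall_lamBondsSeq ν Kt h0 (hk0 i) (hk i) (hdiv i) (Z i) (hkc i) (hc i) (hρn i) (ext i Vk) (boxBonds (LO i) (HI i)) hnV hmin0 hεpos
    (((Node00.mem_regMSCoPOfRecord_iff F 2 ν Kt (k i) (maxDomT ν.M₁ (Z i)) U₀).1 hmin0.1).1 (k i - 1) (Nat.sub_le _ _)) hα3 hα2 haN (X i) (hXΩ i) (hfit i) (hBox i) (lo i) (hi i) (W i)
    (hWX i) (hfeedsX i) (hδc i) (hδW i)

end Summit.QuantumFields.YangMills.BalabanUVNodes.N12WindowGaugeLetterUniformSocketLam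

end
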